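import Summits.BirchSwinnertonDyer.Rank1Residual.Additive.GordThreeCycLowerCore
import Summits.BirchSwinnertonDyer.Rank1Residual.Additive.X3RatMainConjLowerBound
import Summits.BirchSwinnertonDyer.Rank1Residual.Additive.CensusX41UnitCoefficient
import HarnessLib

/-!
# The Gord3 rows — (G)-ordinary, defect 2, `p = 3`, analytic rank `0`: `BSD(E,3)` from the RATIONAL
# odd-branch main conjecture of the twist + ONE unit coefficient, WITHOUT the exact-leading-term
# binder (cell `b2b-bsdres`, team n1011, seat n1011-p06 gen 2, OWNERS row T-N10R, phase 3)

HONEST FRAMING (cell `b2b-bsdres`, run/shared/lean/b2b/bsd-rank1-residual/, verbatim in every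
file): the goal of the cell is to DELETE the COMBINATION-SHAPED residual classes of the
Birch–Swinnerton-Dyer formula for ALL analytic-rank `≤ 1` elliptic curves over `ℚ` — "full BSD
formula for every rank `≤ 1` curve in class `C`" assembled STRICTLY from published theorems — so
that the rank-`≤ 1` remainder becomes exactly the CONSTRUCTION-SHAPED classes, which are TYPED
(missing-input `Prop`s), NOT attempted. This is not "finishing BSD". Team n1011 (X4 ∧ `p = 3` / the
additive block, §I items N10 / N11): research routes; prove what is provable now; no claim beyond
the stated classes; X4♯(G-ord) / X3♯(G-ord) stay CONSTRUCTION-SHAPED; labels / census / located gap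
UNCHANGED; nothing is booked. Theorems only (no definition, no named fact minted; the Literature
inputs are the explicit binders `hDel3 : Delbourgo2002.mainTheorem_three`, `hK`, `hW16`, `hDel`).

## What and why

`GordRatMainConjLowerBoundOdd.lean` (same seat, p249862) turns the typed RATIONAL odd-branch main
conjecture `ChiBranchRatCharEqOddAt W p` of the good-ordinary twist `E♭` plus ONE unit coefficient of
the Néron-normalised branch `ϖ⁻ · L_p⁻(f♭, α♭, ω^{(p−1)/2}, T)` into the decl of record
`CycLowerLeadingTermAt W p` at every `p ≡ 3 (mod 4)`, `p = 3` INCLUDED; but its Miller-currency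
consequences needed Delbourgo 2002 (A)+(B) through additive-p2's core, printed for `p ≥ 5`, so at
`p = 3` the seat's only end (`GordRatMainConjLowerBoundExact.lean`, p251515) carried the extra typed
binder `ExactLeadingTermAt W 3`. Since then n1011-p16 landed `Delbourgo2002.mainTheorem_three`
(p250885), the bridge `TypeGOrd.delbourgo2002_three` and `GordThreeCycLowerCore.lean` (p251417 /
p251647): on `TypeGOrd W 3 ∧ Addv W 3`, non-CM, `r_an = 0`, `CycLowerLeadingTermAt W 3` ALONE gives the
LOWER half off the anomalous rows and `BSD(E,3)` with the printed upper halves. This file is the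
composition — the binder-free Gord3 end of row T-N10R:

* §1 X4♯(G-ord) at `3` (`e = 2` is automatic at `3`, `semistabilityIndex_eq_two_of_typeG_three`):
  `ChiBranchRatCharEqOddAt W 3` + certificate ⟹ `CycLowerLeadingTermAt W 3`
  (`ClassX4Gord.cycLowerLeadingTermAt_three_of_ratCharEqOdd_of_unitCoeff`) ⟹ off the anomalous rows
  `MissingLowerBoundAt W 3`, on every row the slack `ord₃ #Ш_an ≤ ord₃ #Ш + 2`, and with `ρ̄_{E,3}`
  onto `BSD(E,3)` (`ClassX4Gord.bsdp_three_rankZero_of_ratCharEqOdd_of_unitCoeff_of_surj`; upper half =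
  additive-p2's `ω`-branch chain + n1011-p14's certificate-free tower, through p16's
  `ClassX4Gord.bsdp_three_rankZero_of_cycLower_of_nonAnomalous_of_surj`).
* §2 X3♯(G-ord) at `3`: the same with Wuthrich's reducible upper half (Thm. 16, `hW16`).
* §3 UNIT ROWS (`L(E,1) = q·Ω_E`, `ord₃ q = 0`): the certificate is FREE (census-ctyper-1's
  `CensusX41.unitCoeffCert_odd`, `n = 0`), so the rational odd-branch main conjecture ALONE gives
  `CycLowerLeadingTermAt W 3` and the ends of §1/§2. On X4 ∧ surj(3) unit rows the LOWER half is
  numerically idle (`3 ∤ #E(ℚ)_tors`); on X3 rows (`E[3]` reducible, `3`-torsion possible) it is not.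

So on the (G-ord)@3 share of N11 / N10 (Q6 Stage A's 17 Gord3 register rows and the 3 730
(G-ord)@3 rank-`0` cells of n1011-p14's engine 1, non-anomalous non-CM rows) the kernel input is
EXACTLY: the rational `ω`-branch main conjecture of `E♭` at `3` (typed, `ChiBranchRatCharEqOddAt W 3`;
its Eisenstein = lower direction is the LOCATED GAP — no printed source; its Kato direction is EPW
2006 Thm. 5.1.2 / Kato 17.4) + one computable unit coefficient (Q6) — and NOTHING ELSE typed.
X4♯(G-ord) / X3♯(G-ord) stay CONSTRUCTION-SHAPED; nothing booked; no label change.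

References: D. Delbourgo, J. Number Theory 95 (2002) Theorem (A), (B) (p. 40), ℓ_p(E) (p. 39)
[Delbourgo2002]; D. Delbourgo, Compositio Math. 113 (1998) Prop. 4 (p. 144) [Delbourgo1998];
K. Kato, Astérisque 295 (2004) Thm. 17.4 (3) (p. 273) [Kato2004Asterisque]; C. Wuthrich, J. London
Math. Soc. 90 (2014) Thm. 16 (p. 397) [Wuthrich2014]; Mazur–Tate–Teitelbaum, Invent. Math. 84 (1986)
§I.13–I.14 [MazurTateTeitelbaum1986Invent]; Pal, Proc. AMS (2012) Thm. 3.2 [Pal2012];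
Burungale–Castella–Skinner, IMRN 2025 Thm. 1.1.2 (a) (shape only) [BurungaleCastellaSkinner2025];
R. L. Miller, LMS J. Comput. Math. 14 (2011) Def. 1.1 [Miller2011LMS].
-/

noncomputable section

open scoped Classical MatrixGroups ModularForm NumberField

open CongruenceSubgroup WeierstrassCurve NumberField Literature.NumberTheory.EllipticCurves
  Literature.NumberTheory.EllipticCurves.ModularForms
  Literature.NumberTheory.EllipticCurves.Rank1Residual
  Literature.NumberTheory.EllipticCurves.Rank1Residual.Typed
  IsDedekindDomain

namespace Summit.BirchSwinnertonDyer.Rank1Residual.Additive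

variable {W : WeierstrassCurve ℚ} [W.IsElliptic] [W.IsGloballyMinimal]

/-! ### §1 X4♯(G-ord) at `3` -/

/-- **X4♯(G-ord) at `3` (Kodaira `I₀*`, `e = 2` automatic): `CycLowerLeadingTermAt W 3` from the rational
ODD branch main conjecture of the twist and the `μ`-certificate** — the `p = 3` instance of
`ClassX4Gord.cycLowerLeadingTermAt_of_ratCharEqOdd_of_unitCoeff` with the defect discharged by
`semistabilityIndex_eq_two_of_typeG_three`. Binders: modularity `hmod`, a modular-parametrisation datum
`hmodD`. [cite: MazurTateTeitelbaum1986Invent, §I.14] -/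
theorem ClassX4Gord.cycLowerLeadingTermAt_three_of_ratCharEqOdd_of_unitCoeff [Fact (Nat.Prime 3)]
    (hmod : hasEntireLFunction_rat) (hmodD : nonempty_modularParametrizationData)
    (hX : ClassX4Gord W 3) (hMC : ChiBranchRatCharEqOddAt W 3)
    (hcert : ∀ (V : WeierstrassCurve ℚ) [V.IsElliptic] [V.IsGloballyMinimal] (C : VariableChange ℚ),
      GoodOrd V 3 → C • V.quadraticTwist (-(3 : ℚ)) = W →
      ∀ {N : ℕ} [NeZero N] (f : CuspForm (Gamma0 N) 2), IsNewformOf V f →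
      ∀ ϖ : ℚ, (ϖ : ℝ) * V.imaginaryPeriodRat = minusPeriod f →
      ∃ n : ℕ, ‖PowerSeries.coeff n
        (PowerSeries.C (ϖ : ℚ_[3]) * padicLFunctionMinusBranch f (unitRoot V 3 : ℚ_[3]) (3 / 2))‖ = 1) :
    CycLowerLeadingTermAt W 3 :=
  ClassX4Gord.cycLowerLeadingTermAt_of_ratCharEqOdd_of_unitCoeff hmod hmodD hX
    (semistabilityIndex_eq_two_of_typeG_three W hX.typeGOrd.typeG hX.addv.2) (by norm_num) hMC
    (by exact_mod_cast hcert)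

/-- **X4♯(G-ord) at `3`, `r_an = 0`, non-CM, OFF the anomalous rows: the LOWER half
`ord₃ #Ш_an(E) ≤ ord₃ #Ш(E)` from the rational ODD branch main conjecture and the `μ`-certificate** —
through `CycLowerLeadingTermAt W 3` and n1011-p16's reduction over Delbourgo 2002 at `3` (`hDel3`, `ℓ = 1`
on the non-anomalous rows). No `ExactLeadingTermAt` binder. X4♯(G-ord) stays CONSTRUCTION-SHAPED.
[cite: Delbourgo2002, Theorem (A), (B) (p. 40)] [cite: Miller2011LMS, Def. 1.1] -/
theorem ClassX4Gord.missingLowerBoundAt_three_rankZero_of_ratCharEqOdd_of_unitCoeff [Fact (Nat.Prime 3)]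
    (hDel3 : Delbourgo2002.mainTheorem_three)
    (hGZK : rank_eq_analyticRank_of_analyticRank_le_one) (hmod : hasEntireLFunction_rat)
    (hmodD : nonempty_modularParametrizationData)
    (hX : ClassX4Gord W 3) (hcm : ¬ W.HasCM) (hr : W.analyticRank = 0)
    (hna : Delbourgo2002.ReductionNonAnomalous W 3) (hMC : ChiBranchRatCharEqOddAt W 3)
    (hcert : ∀ (V : WeierstrassCurve ℚ) [V.IsElliptic] [V.IsGloballyMinimal] (C : VariableChange ℚ),
      GoodOrd V 3 → C • V.quadraticTwist (-(3 : ℚ)) = W →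
      ∀ {N : ℕ} [NeZero N] (f : CuspForm (Gamma0 N) 2), IsNewformOf V f →
      ∀ ϖ : ℚ, (ϖ : ℝ) * V.imaginaryPeriodRat = minusPeriod f →
      ∃ n : ℕ, ‖PowerSeries.coeff n
        (PowerSeries.C (ϖ : ℚ_[3]) * padicLFunctionMinusBranch f (unitRoot V 3 : ℚ_[3]) (3 / 2))‖ = 1) :
    MissingLowerBoundAt W 3 :=
  ClassX4Gord.missingLowerBoundAt_three_rankZero_of_cycLower_of_nonAnomalous hDel3 hGZK hmod hX hcm hr
    hna (hX.cycLowerLeadingTermAt_three_of_ratCharEqOdd_of_unitCoeff hmod hmodD hMC hcert)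

/-- **X4♯(G-ord) at `3`, `r_an = 0`, non-CM, EVERY row (anomalous included): `#Ш_an = q` with
`ord₃ q ≤ ord₃ #Ш(E) + 2`** from the rational ODD branch main conjecture and the `μ`-certificate (the
slack `ℓ ∣ 9` of Delbourgo 2002 at `3`, flag `Del02-ThmB-ellp-anomalous`; n1011-p16's
`TypeGOrd.padicValRat_shaAn_le_add_two_three_of_cycLower`).
[cite: Delbourgo2002, Theorem (A), (B) (p. 40), ℓ_p(E) (p. 39)] -/
theorem ClassX4Gord.padicValRat_shaAn_le_add_two_three_of_ratCharEqOdd_of_unitCoeff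
    [Fact (Nat.Prime 3)] (hDel3 : Delbourgo2002.mainTheorem_three)
    (hGZK : rank_eq_analyticRank_of_analyticRank_le_one) (hmod : hasEntireLFunction_rat)
    (hmodD : nonempty_modularParametrizationData)
    (hX : ClassX4Gord W 3) (hcm : ¬ W.HasCM) (hr : W.analyticRank = 0)
    (hMC : ChiBranchRatCharEqOddAt W 3)
    (hcert : ∀ (V : WeierstrassCurve ℚ) [V.IsElliptic] [V.IsGloballyMinimal] (C : VariableChange ℚ),
      GoodOrd V 3 → C • V.quadraticTwist (-(3 : ℚ)) = W →
      ∀ {N : ℕ} [NeZero N] (f : CuspForm (Gamma0 N) 2), IsNewformOf V f →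
      ∀ ϖ : ℚ, (ϖ : ℝ) * V.imaginaryPeriodRat = minusPeriod f →
      ∃ n : ℕ, ‖PowerSeries.coeff n
        (PowerSeries.C (ϖ : ℚ_[3]) * padicLFunctionMinusBranch f (unitRoot V 3 : ℚ_[3]) (3 / 2))‖ = 1) :
    ∃ q : ℚ, shaAn W = (q : ℂ) ∧ padicValRat 3 q ≤ padicValNat 3 W.shaOrder + 2 :=
  hX.typeGOrd.padicValRat_shaAn_le_add_two_three_of_cycLower hDel3 hGZK hmod hX.addv.2 hcm hr
    (hX.cycLowerLeadingTermAt_three_of_ratCharEqOdd_of_unitCoeff hmod hmodD hMC hcert)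

/-- **The Gord3 rows of N11 — X4♯(G-ord) at `3` ∧ surj(3), `r_an = 0`, non-CM, non-anomalous:
`BSD(E,3)`** ⟸ the rational ODD branch main conjecture of the twist (`ChiBranchRatCharEqOddAt W 3`) +
ONE unit coefficient, and NOTHING ELSE typed: lower half = this file, upper half IN PRINT and
certificate-free at `3` (Kato's branch-component divisibility `hK` through additive-p2's `ω`-branch
chain and n1011-p14's tower, Delbourgo 1998 Prop. 4 `hDel`; n1011-p16's
`ClassX4Gord.bsdp_three_rankZero_of_cycLower_of_nonAnomalous_of_surj`). Supersedes, on the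
non-anomalous rows, the same seat's `ClassX4Gord.bsdp_three_of_ratCharEqOdd_of_unitCoeff_of_exact_of_surj`
(which carries `ExactLeadingTermAt W 3`). Nothing booked; X4♯(G-ord) stays CONSTRUCTION-SHAPED.
[cite: Delbourgo2002, Theorem (A), (B) (p. 40)] [cite: Kato2004Asterisque, Thm. 17.4 (3) (p. 273)]
[cite: Delbourgo1998, Prop. 4 (p. 144)] [cite: Miller2011LMS, §1 and Def. 1.1] -/
theorem ClassX4Gord.bsdp_three_rankZero_of_ratCharEqOdd_of_unitCoeff_of_surj [Fact (Nat.Prime 3)]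
    (hDel3 : Delbourgo2002.mainTheorem_three)
    (hK : Kato2004.charIdeal_dvd_padicLFunctionBranch_component_of_surjective)
    (hDel : Delbourgo1998.prop4_rankZero_pow_dvd_constantCoeff)
    (hGZK : rank_eq_analyticRank_of_analyticRank_le_one) (hmod : hasEntireLFunction_rat)
    (hmodD : nonempty_modularParametrizationData)
    (hX : ClassX4Gord W 3) (hcm : ¬ W.HasCM) (hr : W.analyticRank = 0) (hsurj : Surj W 3)
    (hna : Delbourgo2002.ReductionNonAnomalous W 3) (hMC : ChiBranchRatCharEqOddAt W 3)
    (hcert : ∀ (V : WeierstrassCurve ℚ) [V.IsElliptic] [V.IsGloballyMinimal] (C : VariableChange ℚ),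
      GoodOrd V 3 → C • V.quadraticTwist (-(3 : ℚ)) = W →
      ∀ {N : ℕ} [NeZero N] (f : CuspForm (Gamma0 N) 2), IsNewformOf V f →
      ∀ ϖ : ℚ, (ϖ : ℝ) * V.imaginaryPeriodRat = minusPeriod f →
      ∃ n : ℕ, ‖PowerSeries.coeff n
        (PowerSeries.C (ϖ : ℚ_[3]) * padicLFunctionMinusBranch f (unitRoot V 3 : ℚ_[3]) (3 / 2))‖ = 1) :
    BSDp W 3 :=
  ClassX4Gord.bsdp_three_rankZero_of_cycLower_of_nonAnomalous_of_surj hDel3 hK hDel hGZK hmod hmodD hX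
    hcm hr hsurj hna (hX.cycLowerLeadingTermAt_three_of_ratCharEqOdd_of_unitCoeff hmod hmodD hMC hcert)

/-! ### §2 X3♯(G-ord) at `3`: the same with Wuthrich's reducible upper half -/

/-- **X3♯(G-ord) at `3`: `CycLowerLeadingTermAt W 3` from the rational ODD branch main conjecture and
the certificate** (`e = 2` automatic at `3`). [cite: MazurTateTeitelbaum1986Invent, §I.14] -/
theorem ClassX3Gord.cycLowerLeadingTermAt_three_of_ratCharEqOdd_of_unitCoeff [Fact (Nat.Prime 3)]
    (hmod : hasEntireLFunction_rat) (hmodD : nonempty_modularParametrizationData)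
    (hX : ClassX3Gord W 3) (hMC : ChiBranchRatCharEqOddAt W 3)
    (hcert : ∀ (V : WeierstrassCurve ℚ) [V.IsElliptic] [V.IsGloballyMinimal] (C : VariableChange ℚ),
      GoodOrd V 3 → C • V.quadraticTwist (-(3 : ℚ)) = W →
      ∀ {N : ℕ} [NeZero N] (f : CuspForm (Gamma0 N) 2), IsNewformOf V f →
      ∀ ϖ : ℚ, (ϖ : ℝ) * V.imaginaryPeriodRat = minusPeriod f →
      ∃ n : ℕ, ‖PowerSeries.coeff n
        (PowerSeries.C (ϖ : ℚ_[3]) * padicLFunctionMinusBranch f (unitRoot V 3 : ℚ_[3]) (3 / 2))‖ = 1) :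
    CycLowerLeadingTermAt W 3 :=
  ClassX3Gord.cycLowerLeadingTermAt_of_ratCharEqOdd_of_unitCoeff hmod hmodD hX
    (semistabilityIndex_eq_two_of_typeG_three W hX.typeGOrd.typeG hX.addv) (by norm_num) hMC
    (by exact_mod_cast hcert)

/-- **X3♯(G-ord) at `3`, `r_an = 0`, non-CM, OFF the anomalous rows: the LOWER half from the rational ODD
branch main conjecture and the certificate** (reducible `E[3]`: Delbourgo 2002 has no image
hypothesis). X3♯(G-ord) stays CONSTRUCTION-SHAPED.
[cite: Delbourgo2002, Theorem (A), (B) (p. 40)] [cite: Miller2011LMS, Def. 1.1] -/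
theorem ClassX3Gord.missingLowerBoundAt_three_rankZero_of_ratCharEqOdd_of_unitCoeff [Fact (Nat.Prime 3)]
    (hDel3 : Delbourgo2002.mainTheorem_three)
    (hGZK : rank_eq_analyticRank_of_analyticRank_le_one) (hmod : hasEntireLFunction_rat)
    (hmodD : nonempty_modularParametrizationData)
    (hX : ClassX3Gord W 3) (hcm : ¬ W.HasCM) (hr : W.analyticRank = 0)
    (hna : Delbourgo2002.ReductionNonAnomalous W 3) (hMC : ChiBranchRatCharEqOddAt W 3)
    (hcert : ∀ (V : WeierstrassCurve ℚ) [V.IsElliptic] [V.IsGloballyMinimal] (C : VariableChange ℚ),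
      GoodOrd V 3 → C • V.quadraticTwist (-(3 : ℚ)) = W →
      ∀ {N : ℕ} [NeZero N] (f : CuspForm (Gamma0 N) 2), IsNewformOf V f →
      ∀ ϖ : ℚ, (ϖ : ℝ) * V.imaginaryPeriodRat = minusPeriod f →
      ∃ n : ℕ, ‖PowerSeries.coeff n
        (PowerSeries.C (ϖ : ℚ_[3]) * padicLFunctionMinusBranch f (unitRoot V 3 : ℚ_[3]) (3 / 2))‖ = 1) :
    MissingLowerBoundAt W 3 :=
  ClassX3Gord.missingLowerBoundAt_three_rankZero_of_cycLower_of_nonAnomalous hDel3 hGZK hmod hX hcm hr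
    hna (hX.cycLowerLeadingTermAt_three_of_ratCharEqOdd_of_unitCoeff hmod hmodD hMC hcert)

/-- **X3♯(G-ord) at `3`, `r_an = 0`, non-CM, non-anomalous: `BSD(E,3)`** ⟸ the rational ODD branch
main conjecture of the twist + ONE unit coefficient; upper half IN PRINT (Wuthrich 2014 Thm. 16
`ω`-component `hW16`, Delbourgo 1998 Prop. 4 `hDel`; n1011-p16's
`ClassX3Gord.bsdp_three_rankZero_of_cycLower_of_nonAnomalous`). No image hypothesis, no
`ExactLeadingTermAt` binder. Nothing booked; X3♯(G-ord) stays CONSTRUCTION-SHAPED.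
[cite: Delbourgo2002, Theorem (A), (B) (p. 40)] [cite: Wuthrich2014, Thm. 16 (p. 397)]
[cite: Delbourgo1998, Prop. 4 (p. 144)] [cite: Miller2011LMS, §1 and Def. 1.1] -/
theorem ClassX3Gord.bsdp_three_rankZero_of_ratCharEqOdd_of_unitCoeff [Fact (Nat.Prime 3)]
    (hDel3 : Delbourgo2002.mainTheorem_three)
    (hW16 : Wuthrich2014.thm16_minusEigenCharIdeal_dvd_cyclotomicThree)
    (hDel : Delbourgo1998.prop4_rankZero_pow_dvd_constantCoeff)
    (hGZK : rank_eq_analyticRank_of_analyticRank_le_one) (hmod : hasEntireLFunction_rat)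
    (hmodD : nonempty_modularParametrizationData)
    (hX : ClassX3Gord W 3) (hcm : ¬ W.HasCM) (hr : W.analyticRank = 0)
    (hna : Delbourgo2002.ReductionNonAnomalous W 3) (hMC : ChiBranchRatCharEqOddAt W 3)
    (hcert : ∀ (V : WeierstrassCurve ℚ) [V.IsElliptic] [V.IsGloballyMinimal] (C : VariableChange ℚ),
      GoodOrd V 3 → C • V.quadraticTwist (-(3 : ℚ)) = W →
      ∀ {N : ℕ} [NeZero N] (f : CuspForm (Gamma0 N) 2), IsNewformOf V f →
      ∀ ϖ : ℚ, (ϖ : ℝ) * V.imaginaryPeriodRat = minusPeriod f →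
      ∃ n : ℕ, ‖PowerSeries.coeff n
        (PowerSeries.C (ϖ : ℚ_[3]) * padicLFunctionMinusBranch f (unitRoot V 3 : ℚ_[3]) (3 / 2))‖ = 1) :
    BSDp W 3 :=
  ClassX3Gord.bsdp_three_rankZero_of_cycLower_of_nonAnomalous hDel3 hW16 hDel hGZK hmod hmodD hX hcm hr
    hna (hX.cycLowerLeadingTermAt_three_of_ratCharEqOdd_of_unitCoeff hmod hmodD hMC hcert)

/-! ### §3 The unit rows: the certificate is free, the rational main conjecture alone suffices -/

/-- **X4♯(G-ord) at `3`, UNIT rows (`L(E,1) = q·Ω_E`, `q ≠ 0`, `ord₃ q = 0`): `CycLowerLeadingTermAt W 3`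
from the rational ODD branch main conjecture ALONE** — the `μ`-certificate holds with `n = 0`
(census-ctyper-1's `CensusX41.unitCoeffCert_odd`: the constant coefficient of the Néron-normalised
minus branch is `c_∞(E)·q`, a `3`-adic unit). [cite: MazurTateTeitelbaum1986Invent, §I.13–I.14]
[cite: Pal2012, Thm. 3.2] -/
theorem ClassX4Gord.cycLowerLeadingTermAt_three_of_ratCharEqOdd_of_unitLValue [Fact (Nat.Prime 3)]
    (hmod : hasEntireLFunction_rat) (hmodD : nonempty_modularParametrizationData)
    (hX : ClassX4Gord W 3) (hMC : ChiBranchRatCharEqOddAt W 3)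
    {q : ℚ} (hq : W.entireLFunction 1 = (q : ℂ) * (W.realPeriodRat : ℂ)) (hq0 : q ≠ 0)
    (hv : padicValRat 3 q = 0) :
    CycLowerLeadingTermAt W 3 :=
  hX.cycLowerLeadingTermAt_three_of_ratCharEqOdd_of_unitCoeff hmod hmodD hMC
    (by exact_mod_cast CensusX41.unitCoeffCert_odd 3 hmod (by norm_num) W hX.addv.2 hq hq0 hv)

/-- **X4♯(G-ord) at `3` ∧ surj(3), `r_an = 0`, non-CM, non-anomalous, UNIT rows: `BSD(E,3)` from the
rational ODD branch main conjecture ALONE** (certificate free on the unit rows). Bookkeeping remark: on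
these rows `3 ∤ #E(ℚ)_tors` (surjectivity), so the LOWER half is numerically idle there; the content of
the statement is the composition, recorded so that the Q6 register's unit calibration rows have a
named end. Nothing booked. [cite: Delbourgo2002, Theorem (A), (B) (p. 40)]
[cite: Kato2004Asterisque, Thm. 17.4 (3) (p. 273)] [cite: Delbourgo1998, Prop. 4 (p. 144)]
[cite: Miller2011LMS, §1 and Def. 1.1] -/
theorem ClassX4Gord.bsdp_three_rankZero_of_ratCharEqOdd_of_unitLValue_of_surj [Fact (Nat.Prime 3)]
    (hDel3 : Delbourgo2002.mainTheorem_three)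
    (hK : Kato2004.charIdeal_dvd_padicLFunctionBranch_component_of_surjective)
    (hDel : Delbourgo1998.prop4_rankZero_pow_dvd_constantCoeff)
    (hGZK : rank_eq_analyticRank_of_analyticRank_le_one) (hmod : hasEntireLFunction_rat)
    (hmodD : nonempty_modularParametrizationData)
    (hX : ClassX4Gord W 3) (hcm : ¬ W.HasCM) (hr : W.analyticRank = 0) (hsurj : Surj W 3)
    (hna : Delbourgo2002.ReductionNonAnomalous W 3) (hMC : ChiBranchRatCharEqOddAt W 3)
    {q : ℚ} (hq : W.entireLFunction 1 = (q : ℂ) * (W.realPeriodRat : ℂ)) (hq0 : q ≠ 0)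
    (hv : padicValRat 3 q = 0) :
    BSDp W 3 :=
  ClassX4Gord.bsdp_three_rankZero_of_cycLower_of_nonAnomalous_of_surj hDel3 hK hDel hGZK hmod hmodD hX
    hcm hr hsurj hna (hX.cycLowerLeadingTermAt_three_of_ratCharEqOdd_of_unitLValue hmod hmodD hMC hq hq0 hv)

/-- **X3♯(G-ord) at `3`, UNIT rows: `CycLowerLeadingTermAt W 3` from the rational ODD branch main
conjecture ALONE** (certificate free, `CensusX41.unitCoeffCert_odd`).
[cite: MazurTateTeitelbaum1986Invent, §I.13–I.14] [cite: Pal2012, Thm. 3.2] -/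
theorem ClassX3Gord.cycLowerLeadingTermAt_three_of_ratCharEqOdd_of_unitLValue [Fact (Nat.Prime 3)]
    (hmod : hasEntireLFunction_rat) (hmodD : nonempty_modularParametrizationData)
    (hX : ClassX3Gord W 3) (hMC : ChiBranchRatCharEqOddAt W 3)
    {q : ℚ} (hq : W.entireLFunction 1 = (q : ℂ) * (W.realPeriodRat : ℂ)) (hq0 : q ≠ 0)
    (hv : padicValRat 3 q = 0) :
    CycLowerLeadingTermAt W 3 :=
  hX.cycLowerLeadingTermAt_three_of_ratCharEqOdd_of_unitCoeff hmod hmodD hMC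
    (by exact_mod_cast CensusX41.unitCoeffCert_odd 3 hmod (by norm_num) W hX.addv hq hq0 hv)

/-- **X3♯(G-ord) at `3`, `r_an = 0`, non-CM, non-anomalous, UNIT rows: `BSD(E,3)` from the rational ODD
branch main conjecture ALONE** + the printed upper half (Wuthrich Thm. 16, Delbourgo Prop. 4). Here
`E[3]` is reducible and `3`-torsion is possible, so the LOWER half `ord₃ #Ш_an ≤ ord₃ #Ш` has content
even on the unit rows (`ord₃ #Ш_an = 2·ord₃ #E(ℚ)_tors − ord₃ ∏ c_ℓ`). Nothing booked; X3♯(G-ord) stays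
CONSTRUCTION-SHAPED. [cite: Delbourgo2002, Theorem (A), (B) (p. 40)] [cite: Wuthrich2014, Thm. 16 (p. 397)]
[cite: Delbourgo1998, Prop. 4 (p. 144)] [cite: Miller2011LMS, §1 and Def. 1.1] -/
theorem ClassX3Gord.bsdp_three_rankZero_of_ratCharEqOdd_of_unitLValue [Fact (Nat.Prime 3)]
    (hDel3 : Delbourgo2002.mainTheorem_three)
    (hW16 : Wuthrich2014.thm16_minusEigenCharIdeal_dvd_cyclotomicThree)
    (hDel : Delbourgo1998.prop4_rankZero_pow_dvd_constantCoeff)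
    (hGZK : rank_eq_analyticRank_of_analyticRank_le_one) (hmod : hasEntireLFunction_rat)
    (hmodD : nonempty_modularParametrizationData)
    (hX : ClassX3Gord W 3) (hcm : ¬ W.HasCM) (hr : W.analyticRank = 0)
    (hna : Delbourgo2002.ReductionNonAnomalous W 3) (hMC : ChiBranchRatCharEqOddAt W 3)
    {q : ℚ} (hq : W.entireLFunction 1 = (q : ℂ) * (W.realPeriodRat : ℂ)) (hq0 : q ≠ 0)
    (hv : padicValRat 3 q = 0) :
    BSDp W 3 :=
  ClassX3Gord.bsdp_three_rankZero_of_cycLower_of_nonAnomalous hDel3 hW16 hDel hGZK hmod hmodD hX hcm hr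
    hna (hX.cycLowerLeadingTermAt_three_of_ratCharEqOdd_of_unitLValue hmod hmodD hMC hq hq0 hv)

end Summit.BirchSwinnertonDyer.Rank1Residual.Additive

end
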